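import Literature.AlgebraicGeometry.ComplexMultiplication.ReflexFieldsMeetRealCMHodge
import Literature.NumberTheory.ComplexMultiplication.ComplexReflexFieldStabilizer
import Literature.NumberTheory.ComplexMultiplication.CMTypeDictionary
import HarnessLib

/-!
# Two CM abelian varieties whose REFLEX FIELDS meet in a real field: `Hg(A₀ × A₁) = Hg(A₀) × Hg(A₁)` and the Hodge
# conjecture on every `A₀^a × A₁^b`

COR-CM (cell `pub-hodgecm2`, binder seat `b16` gen 42, count-neutral claim CM33-QUADDISTINCT, file F7; theorems only, no
definition, no named fact, no `sorry`).  NEW as stated, hence under `Summits/`.  The criterion of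
`CorCM/ReflexFieldsMeetRealCMHodge` (fields of definition meeting in a real field) in Shimura's own vocabulary: by
`Literature/NumberTheory/ComplexMultiplication/ComplexReflexFieldStabilizer` (Prop. 28 for `Aut(ℂ)`: the stabiliser
of `Φ` is `Aut(ℂ/K*)`, `K* = traceField Φ = ℚ(tr_Φ(K)) ⊂ ℂ` the complex reflex field) the reflex fields themselves are
fields of definition, so:

* `finiteDimensional_traceField` — `K* ⊂ ℂ` has finite degree (it is the image of the Galois-side reflex field);
* **`isNondegenerateFamily_iff_forall_of_traceField_inf_real`** — if complex conjugation fixes `K₀* ∩ K₁*` pointwise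
  (the two REFLEX FIELDS MEET IN A TOTALLY REAL FIELD — both are CM or totally real, so their intersection is totally
  real iff it lies in `ℝ`), then `(Φ_{i₀}, Φ_{i₁})` is nondegenerate iff both members are;
  `cmFamilyRank_add_card_eq_of_traceField_inf_real`;
* **`hodgeConjectureFor_prod_of_traceField_inf_real`**, `not_exists_exceptional_prod_of_traceField_inf_real` — for
  nondegenerate members, the Hodge conjecture and `B• = D•` on every `⨁_{j<N} A_{π j}`, no exceptional classes.

This is Gordon's mechanism [Gordon1999HodgeAVSurvey, §3 Theorem, proof] with Galois closures replaced by reflex fields;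
it is strictly stronger than `CorCM/RealIntersectionCMFieldsHodge` (`L₀ ∩ L₁` totally real) since `K* ⊆ L`.
HC_CM is NOT touched.

## References

* [Shimura1998] G. Shimura, *Abelian Varieties with Complex Multiplication and Modular Functions*, §8.3 Prop. 28.
* [Gordon1999HodgeAVSurvey] B. B. Gordon, *A survey of the Hodge conjecture for abelian varieties*, §3 Theorem, 7.5–7.7,
  10.10.

Provenance: Literature home (namespace `Literature.AlgebraicGeometry.ComplexMultiplication.ComplexReflexFieldsMeetRealCMHodge`) of the Summits-side `CorCM/ComplexReflexFieldsMeetRealCMHodge` (cell `pub-hodgecm2`, COR-CM; all its imports are `Literature/`, Mathlib and the already re-homed `ReflexFieldsMeetRealCMHodge`), which `Literature/` may not import; theorems only, no named fact, no definition. Nothing here bears on `HC_CM`. Lane `lit-hodgefound` (Layer A3: CM types, their Kubota ranks and Galois combinatorics), seat p20.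
-/

noncomputable section

open _root_.CategoryTheory _root_.CategoryTheory.Limits NumberField Module

namespace Literature.AlgebraicGeometry.ComplexMultiplication.ComplexReflexFieldsMeetRealCMHodge

open Literature.AlgebraicGeometry.ComplexMultiplication.ReflexFieldsMeetRealCMHodge Literature.AlgebraicGeometry.ComplexMultiplication.ReflexStabilizersCMHodge Literature.NumberTheory.ComplexMultiplication Literature.AlgebraicGeometry.HodgeTheory Literature.AlgebraicGeometry.Pohlmann1968

open Literature.NumberTheory.ComplexMultiplication
open Literature.AlgebraicGeometry.GaoUllmo2025 (galoisClosure)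
open Literature.AlgebraicGeometry.Motives (AbelianVariety CMType)
open Literature.AlgebraicGeometry.HodgeTheory
open Literature.AlgebraicGeometry.ComplexMultiplication (IsCMTypeRealisation)
open Literature.AlgebraicGeometry.VanGeemen1994 (hodgeClassSpan)
open Literature.AlgebraicGeometry.Pohlmann1968
open Literature.Barriers.HodgeConjecture (divisorClassesSpan)

/-! ## §1 The complex reflex field has finite degree -/

section Finite

variable {K : Type} [Field K] [NumberField K]

/-- **The complex reflex field `K* = ℚ(tr_Φ(K)) ⊂ ℂ` has finite degree over `ℚ`**: it is the image in `ℂ` of the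
Galois-side reflex field inside the Galois closure `K^c` (`lift_reflexField_galoisClosure`).
[cite: Shimura1998, §8.3 Prop. 28] -/
theorem finiteDimensional_traceField (Φ : CMType K) : FiniteDimensional ℚ (traceField Φ) := by
  let R := reflexField ℚ (galoisClosure K) (algValuedIn (algebraMap (galoisClosure K) ℂ) Φ.1)
  have hlift : IntermediateField.lift R = traceField Φ := lift_reflexField_galoisClosure Φ
  let e : traceField Φ ≃ₐ[ℚ] R :=
    (IntermediateField.equivOfEq hlift.symm).trans (IntermediateField.liftAlgEquiv R).symm
  exact LinearEquiv.finiteDimensional e.symm.toLinearEquiv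

end Finite

/-! ## §2 Reflex fields meeting in a real field -/

section Reflex

variable {I : Type} {K : I → Type} [∀ i, Field (K i)] [∀ i, NumberField (K i)] [∀ i, IsCMField (K i)] [Fintype I]
  [DecidableEq I] [Nonempty I] {Φ : ∀ i, CMType (K i)}

/-- **Reflex fields meeting in a real field ⟹ the pair is nondegenerate iff its members are**
(`Hg(A₀ × A₁) = Hg(A₀) × Hg(A₁)`).  Hypotheses: `I = {i₀, i₁}` and complex conjugation fixes `K₀* ∩ K₁*` pointwise,
`K_k* = traceField Φ_{i_k} ⊂ ℂ` the complex reflex fields. [cite: Shimura1998, §8.3 Prop. 28]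
[cite: Gordon1999HodgeAVSurvey, §3 Theorem and 7.5–7.7] -/
theorem isNondegenerateFamily_iff_forall_of_traceField_inf_real {i₀ i₁ : I} (h01 : i₀ ≠ i₁)
    (hI : ∀ j, j = i₀ ∨ j = i₁)
    (hreal : ∀ z : ℂ, z ∈ traceField (Φ i₀) → z ∈ traceField (Φ i₁) → starRingEnd ℂ z = z) :
    CMAlgebra.IsNondegenerateFamily Φ ↔ ∀ i, IsNondegenerate (Φ i) := by
  haveI := finiteDimensional_traceField (Φ i₀)
  haveI := finiteDimensional_traceField (Φ i₁)
  exact isNondegenerateFamily_iff_forall_of_fixingFields_inf_real h01 hI (traceField (Φ i₀)) (traceField (Φ i₁))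
    (forall_smul_mem_iff_of_forall_apply_traceField_eq · (Φ i₀))
    (forall_smul_mem_iff_of_forall_apply_traceField_eq · (Φ i₁)) hreal

/-- **Rank additivity** `rank(Φ₀, Φ₁) + 2 = rank Φ₀ + rank Φ₁ + 1` when the reflex fields meet in a real field.
[cite: Gordon1999HodgeAVSurvey, §3 Theorem (1)] [cite: Shimura1998, §8.3 Prop. 28] -/
theorem cmFamilyRank_add_card_eq_of_traceField_inf_real {i₀ i₁ : I} (h01 : i₀ ≠ i₁) (hI : ∀ j, j = i₀ ∨ j = i₁)
    (hreal : ∀ z : ℂ, z ∈ traceField (Φ i₀) → z ∈ traceField (Φ i₁) → starRingEnd ℂ z = z) :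
    CMAlgebra.cmFamilyRank Φ + Fintype.card I = (∑ i, cmTypeRank (Φ i)) + 1 := by
  haveI := finiteDimensional_traceField (Φ i₀)
  haveI := finiteDimensional_traceField (Φ i₁)
  exact cmFamilyRank_add_card_eq_of_fixingFields_inf_real h01 hI (traceField (Φ i₀)) (traceField (Φ i₁))
    (forall_smul_mem_iff_of_forall_apply_traceField_eq · (Φ i₀))
    (forall_smul_mem_iff_of_forall_apply_traceField_eq · (Φ i₁)) hreal

variable {A : I → AbelianVariety ℂ} {ι : ∀ i, 𝓞 (K i) →+* End (A i)}
  {θ : ∀ i, K i →+* Module.End ℂ (complexBetti (A i).X 1)}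

/-- **The Hodge conjecture on every `A₀^a × A₁^b`** (every `⨁_{j<N} A_{π j}`), with `B• = D•` there, for realisations of
NONDEGENERATE types whose reflex fields meet in a real field — UNCONDITIONAL.
[cite: Gordon1999HodgeAVSurvey, §3 Theorem and 10.10] [cite: Shimura1998, §8.3 Prop. 28] -/
theorem hodgeConjectureFor_prod_of_traceField_inf_real {i₀ i₁ : I} (h01 : i₀ ≠ i₁) (hI : ∀ j, j = i₀ ∨ j = i₁)
    (hreal : ∀ z : ℂ, z ∈ traceField (Φ i₀) → z ∈ traceField (Φ i₁) → starRingEnd ℂ z = z)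
    (hnd : ∀ i, IsNondegenerate (Φ i)) (hA : ∀ i, IsCMTypeRealisation (Φ i) (A i) (ι i) (θ i)) {N : ℕ}
    (π : Fin N → I) :
    HodgeConjectureFor (⨁ fun j : Fin N => A (π j)).dim (⨁ fun j : Fin N => A (π j)).X ∧
      ∀ m : ℕ, hodgeClassSpan (⨁ fun j : Fin N => A (π j)).dim (⨁ fun j : Fin N => A (π j)).X m =
        divisorClassesSpan (⨁ fun j : Fin N => A (π j)).X (⨁ fun j : Fin N => A (π j)).dim m :=
  have h := (isNondegenerateFamily_iff_forall_of_traceField_inf_real h01 hI hreal).2 hnd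
  ⟨h.hodgeConjectureFor_prod hA π, fun m => h.hodgeClassSpan_prod_eq_divisorClassesSpan hA π m⟩

/-- **No exceptional Hodge class on any `A₀^a × A₁^b`** under the same hypotheses.
[cite: Gordon1999HodgeAVSurvey, 7.5 and 7.6.1] -/
theorem not_exists_exceptional_prod_of_traceField_inf_real {i₀ i₁ : I} (h01 : i₀ ≠ i₁) (hI : ∀ j, j = i₀ ∨ j = i₁)
    (hreal : ∀ z : ℂ, z ∈ traceField (Φ i₀) → z ∈ traceField (Φ i₁) → starRingEnd ℂ z = z)
    (hnd : ∀ i, IsNondegenerate (Φ i)) (hA : ∀ i, IsCMTypeRealisation (Φ i) (A i) (ι i) (θ i)) {N : ℕ}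
    (π : Fin N → I) (m : ℕ) :
    ¬∃ c : complexBetti (⨁ fun j : Fin N => A (π j)).X (2 * m), IsRationalClass c ∧
        IsOfHodgeType (⨁ fun j : Fin N => A (π j)).dim (⨁ fun j : Fin N => A (π j)).X (2 * m) m m c ∧
        c ∉ divisorClassesSpan (⨁ fun j : Fin N => A (π j)).X (⨁ fun j : Fin N => A (π j)).dim m :=
  ((isNondegenerateFamily_iff_forall_of_traceField_inf_real h01 hI hreal).2 hnd).not_exists_exceptional_prod hA π m

end Reflex

end Literature.AlgebraicGeometry.ComplexMultiplication.ComplexReflexFieldsMeetRealCMHodge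

end
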